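import Literature.Computability.FineGrained.PPSZNumerics
import Mathlib.Analysis.MeanInequalities
import HarnessLib

/-!
# PPSZ VI: the order from placements, forcing probabilities, and Jensen's step

Topic `Literature/Computability/FineGrained`, sixth file of the line `PPSZ*`. We connect the
combinatorial forcing notion (`PPSZModify.lean`, `PPSZCriticalTrees.lean`) with the probability
estimates (`PPSZRecursion.lean`, `PPSZNumerics.lean`):

* `PPSZ.ordOf α` — the processing order determined by placements `α : V → ℕ`: the variables
  sorted by `(α w, w)` (ties broken by the linear order of `V`; PPSZ: "ranking the variables
  according to their α values, breaking ties by some (any) arbitrary rule"); it enumerates `V`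
  without repetition, and a variable placed strictly before `α v` precedes `v` (`mem_before_ordOf`);
* `PPSZ.forcedCount` — `|Forced_z(G, π_α, z)|`, the number of forced nondefining variables;
* `PPSZ.Picker.card_mul_le_sum_forcedCount` — **Lemma 12's expectation bound**:
  `E_Γ[|Forced_z|] ≥ |N| · q` where `q = (1/K) ∑_{a<K} Q^{(d)}(a/K)` (conditioned space,
  `3t ≤ 2K`, implication bound `D ≥ (3^d−1)/2`), and the unconditioned depth-one variant
  `card_mul_le_sum_forcedCount_one` with `q₁ = (1/K) ∑_{a<K} (a/K)^3` (**Lemma 10**: every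
  nondefining variable has a critical clause);
* `PPSZ.card_mul_rpow_le_sum_rpow` — **Jensen / AM–GM**: `|S| · 2^{avg f} ≤ ∑ 2^{f}`; whence
  `Picker.card_mul_rpow_le_sum` : `|Ω_Γ| · 2^{q |N|} ≤ ∑_{α ∈ Ω_Γ} 2^{|Forced_z(α)|}`
  (the factor `E_Γ[2^{|Forced_z|}] ≥ 2^{E_Γ |Forced_z|}` of Lemma 12 / eq. (7)).

## References

* R. Paturi, P. Pudlák, M. E. Saks, F. Zane, J. ACM 52(3) (2005) 337–364, §3.3 (placements and
  the induced permutation), Lemma 2–3 (convexity: `E[2^X] ≥ 2^{E X}`), §4.1 Lemma 10, §4.2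
  Lemma 12 and Corollary 14. [key `PaturiPudlakSaksZane2005`]
-/

namespace Literature.Computability.FineGrained.PPSZ

open Finset

/-! ### Jensen's inequality for `2^x` -/

/-- **AM–GM / convexity of `2^x`**: for a nonempty finite family, `|s| · 2^{(∑ f)/|s|} ≤ ∑ 2^{f}`.
(The step `E[2^X] ≥ 2^{E[X]}` of PPSZ Lemmas 2–3, from Mathlib's weighted AM–GM inequality.)
[cite: PaturiPudlakSaksZane2005, Lemma 2 ("by the convexity of the exponential function")] -/
theorem card_mul_rpow_le_sum_rpow {ι : Type*} (s : Finset ι) (hs : s.Nonempty) (f : ι → ℝ) :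
    (s.card : ℝ) * (2 : ℝ) ^ ((∑ i ∈ s, f i) / s.card) ≤ ∑ i ∈ s, (2 : ℝ) ^ f i := by
  have hc : (0 : ℝ) < s.card := by exact_mod_cast hs.card_pos
  have key := Real.geom_mean_le_arith_mean_weighted s (fun _ => 1 / (s.card : ℝ))
    (fun i => (2 : ℝ) ^ f i) (fun _ _ => by positivity)
    (by rw [sum_const, nsmul_eq_mul]; field_simp) (fun _ _ => by positivity)
  have hprod : ∏ i ∈ s, ((2 : ℝ) ^ f i) ^ (1 / (s.card : ℝ)) =
      (2 : ℝ) ^ ((∑ i ∈ s, f i) / s.card) := by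
    rw [Finset.sum_div, Real.rpow_sum_of_pos two_pos]
    refine prod_congr rfl fun i _ => ?_
    rw [← Real.rpow_mul zero_le_two, mul_one_div]
  rw [hprod, ← mul_sum] at key
  calc (s.card : ℝ) * (2 : ℝ) ^ ((∑ i ∈ s, f i) / s.card)
      ≤ s.card * (1 / (s.card : ℝ) * ∑ i ∈ s, (2 : ℝ) ^ f i) :=
        mul_le_mul_of_nonneg_left key hc.le
    _ = ∑ i ∈ s, (2 : ℝ) ^ f i := by field_simp

/-! ### The order determined by placements -/

section Order

variable {V : Type*} [LinearOrder V] [Fintype V]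

/-- The Boolean comparison "`(α v, v) ≤ (α w, w)` lexicographically". [cite: PaturiPudlakSaksZane2005, §3.3 ("ranking the variables according to their α values, breaking ties by some (any) arbitrary rule")] -/
def placeLE (α : V → ℕ) (v w : V) : Bool := decide (α v < α w ∨ (α v = α w ∧ v ≤ w))

/-- **The processing order `π_α`** determined by the placements `α`: all variables, sorted by
`(α w, w)`. [cite: PaturiPudlakSaksZane2005, §3.3 (π = π_α)] -/
noncomputable def ordOf (α : V → ℕ) : List V := (univ : Finset V).toList.mergeSort (placeLE α)

omit [Fintype V] in
/-- `placeLE α` is transitive. [folklore] -/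
theorem placeLE_trans (α : V → ℕ) (a b c : V) :
    placeLE α a b → placeLE α b c → placeLE α a c := by
  simp only [placeLE, decide_eq_true_eq]
  rintro (h1 | ⟨h1, h1'⟩) (h2 | ⟨h2, h2'⟩)
  · exact Or.inl (h1.trans h2)
  · exact Or.inl (h2 ▸ h1)
  · exact Or.inl (h1 ▸ h2)
  · exact Or.inr ⟨h1.trans h2, h1'.trans h2'⟩

omit [Fintype V] in
/-- `placeLE α` is total. [folklore] -/
theorem placeLE_total (α : V → ℕ) (a b : V) : (placeLE α a b || placeLE α b a) = true := by
  simp only [placeLE, Bool.or_eq_true, decide_eq_true_eq]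
  rcases lt_trichotomy (α a) (α b) with h | h | h
  · exact Or.inl (Or.inl h)
  · rcases le_total a b with h' | h'
    · exact Or.inl (Or.inr ⟨h, h'⟩)
    · exact Or.inr (Or.inr ⟨h.symm, h'⟩)
  · exact Or.inr (Or.inl h)

/-- `ordOf α` is a permutation of the list of all variables. [folklore] -/
theorem ordOf_perm (α : V → ℕ) : (ordOf α).Perm (univ : Finset V).toList :=
  List.mergeSort_perm _ _

/-- `ordOf α` has no repetition. [folklore] -/
theorem nodup_ordOf (α : V → ℕ) : (ordOf α).Nodup :=
  (ordOf_perm α).nodup_iff.2 (Finset.nodup_toList _)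

/-- Every variable occurs in `ordOf α`. [folklore] -/
theorem mem_ordOf (α : V → ℕ) (v : V) : v ∈ ordOf α :=
  (ordOf_perm α).mem_iff.2 (Finset.mem_toList.2 (mem_univ v))

/-- `ordOf α` is sorted by `(α w, w)`. [cite: PaturiPudlakSaksZane2005, §3.3] -/
theorem pairwise_ordOf (α : V → ℕ) : (ordOf α).Pairwise fun v w => placeLE α v w = true :=
  List.pairwise_mergeSort (placeLE_trans α) (placeLE_total α) _

/-- **Strictly earlier placement means earlier processing**: if `α w < α v` then `w` precedes `v`
in `ordOf α` ("variables with smaller α value will appear before variables with larger α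
value"). [cite: PaturiPudlakSaksZane2005, §3.3] -/
theorem mem_before_ordOf (α : V → ℕ) {v w : V} (h : α w < α v) : w ∈ before (ordOf α) v := by
  classical
  obtain ⟨l₁, l₂, hl⟩ := List.append_of_mem (mem_ordOf α v)
  have hnd := nodup_ordOf α
  rw [hl] at hnd
  have hv1 : v ∉ l₁ := fun hv => by
    have := List.nodup_append.1 hnd
    exact this.2.2 v hv v (by simp) rfl
  rw [hl, before_append_cons hv1, List.mem_toFinset]
  have hw : w ∈ ordOf α := mem_ordOf α w
  rw [hl, List.mem_append, List.mem_cons] at hw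
  rcases hw with hw | rfl | hw
  · exact hw
  · exact absurd h (lt_irrefl _)
  · -- `w` after `v` would mean `placeLE α v w`, contradicting `α w < α v`
    have hp := pairwise_ordOf α
    rw [hl, List.pairwise_append] at hp
    have hvw : placeLE α v w = true := (List.pairwise_cons.1 hp.2.1).1 w hw
    simp only [placeLE, decide_eq_true_eq] at hvw
    rcases hvw with hvw | ⟨hvw, -⟩
    · exact absurd (h.trans hvw) (lt_irrefl _)
    · exact absurd (hvw ▸ h) (lt_irrefl _)

end Order

/-! ### Forced nondefining variables and their expected number -/

section Forcing

variable {V : Type*} [LinearOrder V] [Fintype V]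
variable {G : CNF V} {z : V → Bool} {Dset : Finset V}

/-- `|Forced_z(G, π_α, z)|`: the number of nondefining variables forced along the order of the
placements `α` (implication bound `D`). [cite: PaturiPudlakSaksZane2005, §4.1 (Forced_z = N ∩ Forced)] -/
noncomputable def forcedCount (G : CNF V) (D : ℕ) (z : V → Bool) (Dset : Finset V) (α : V → ℕ) : ℕ :=
  open scoped Classical in
  (univ.filter fun v => v ∉ Dset ∧ IsForced G D (ordOf α) z v).card

/-- The forced count as a sum of indicators over the nondefining variables. [folklore] -/
theorem forcedCount_eq_sum (D : ℕ) (α : V → ℕ) :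
    open scoped Classical in
    (forcedCount G D z Dset α : ℝ) =
      ∑ v ∈ univ.filter (· ∉ Dset), if IsForced G D (ordOf α) z v then (1 : ℝ) else 0 := by
  classical
  unfold forcedCount
  rw [sum_filter, ← sum_boole]
  refine sum_congr rfl fun v _ => ?_
  by_cases h1 : v ∉ Dset <;> by_cases h2 : IsForced G D (ordOf α) z v <;> simp [h1, h2]

namespace Picker

variable (pk : Picker G z Dset) {K t : ℕ}

/-- **Cuts force, in probability**: for a nondefining `v`, the probability that `v` is forced is
at least the probability of the cut event of its depth-`d` tree (`D ≥ (3^d−1)/2`).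
[cite: PaturiPudlakSaksZane2005, Lemma 6 (P(v, G, z) ≥ Q_T) with Lemma 11] -/
theorem prob_cutEvent_le_prob_isForced (hz : Sat z G) (h4 : ∀ C ∈ G, C.length ≤ 4) {d D : ℕ}
    (hD : treeSize d ≤ D) {v : V} (hv : v ∉ Dset) :
    prob (fun β : PSpace Dset K t => pk.cutEvent d {v} (toNat β) (toNat β v)) ≤
      prob fun β : PSpace Dset K t => IsForced G D (ordOf (toNat β)) z v :=
  prob_mono fun _ hβ =>
    pk.isForced_of_cutEvent hz h4 hv hD (fun _ hw => mem_before_ordOf _ hw) hβ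

include pk in
/-- **Expected number of forced nondefining variables** (the heart of Lemma 12 / Corollary 14,
`k = 4`, discrete): in the conditioned space with `3t ≤ 2K`,
`|N| · q ≤ E_Γ[|Forced_z|]` for `q = (1/K)∑_{a<K} Q^{(d)}(a/K)`, written as
`|Ω_Γ| · |N| · q ≤ ∑_α |Forced_z(α)|`. [cite: PaturiPudlakSaksZane2005, Lemma 12–13 and Corollary 14 (eq. (9))] -/
theorem card_mul_le_sum_forcedCount (hz : Sat z G) (h4 : ∀ C ∈ G, C.length ≤ 4) (hK : 0 < K)
    (ht : 0 < t) (htK : 3 * t ≤ 2 * K) {d D : ℕ} (hD : treeSize d ≤ D) :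
    (Fintype.card (PSpace Dset K t) : ℝ) *
        (((univ.filter (· ∉ Dset)).card : ℝ) * ((∑ a ∈ range K, Q d (a / K)) / K)) ≤
      ∑ β : PSpace Dset K t, (forcedCount G D z Dset (toNat β) : ℝ) := by
  classical
  simp only [forcedCount_eq_sum]
  rw [sum_comm]
  have hq : ((univ.filter (· ∉ Dset)).card : ℝ) * ((∑ a ∈ range K, Q d (a / K)) / K) =
      ∑ _v ∈ univ.filter (· ∉ Dset), (∑ a ∈ range K, Q d (a / K)) / K := by
    rw [sum_const, nsmul_eq_mul]
  rw [hq, mul_sum]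
  refine sum_le_sum fun v hv => ?_
  rw [mem_filter] at hv
  have h1 := pk.le_prob_cutEvent_root (K := K) (t := t) hz h4 hK ht htK d hv.2
  have h2 := pk.prob_cutEvent_le_prob_isForced (K := K) (t := t) hz h4 hD hv.2
  have h3 := h1.trans h2
  rw [prob_eq, le_div_iff₀ (by exact_mod_cast card_pSpace_pos hK ht)] at h3
  rw [sum_boole]
  linarith

include pk in
/-- The **depth-one, unconditioned variant (Lemma 10)**: every nondefining variable has a
critical clause (the tree of depth `1`), so in the unconditioned space (`t = K`)
`|N| · q₁ ≤ E[|Forced_z|]` with `q₁ = (1/K) ∑_{a<K} (a/K)^3`, for any `D ≥ 1`.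
[cite: PaturiPudlakSaksZane2005, Lemma 10 ("v is last in that critical clause with probability at least 1/k")] -/
theorem card_mul_le_sum_forcedCount_one (hz : Sat z G) (h4 : ∀ C ∈ G, C.length ≤ 4) (hK : 0 < K)
    {D : ℕ} (hD : 1 ≤ D) :
    (Fintype.card (PSpace Dset K K) : ℝ) *
        (((univ.filter (· ∉ Dset)).card : ℝ) * ((∑ a ∈ range K, ((a : ℝ) / K) ^ 3) / K)) ≤
      ∑ β : PSpace Dset K K, (forcedCount G D z Dset (toNat β) : ℝ) := by
  classical
  simp only [forcedCount_eq_sum]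
  rw [sum_comm]
  have hq : ((univ.filter (· ∉ Dset)).card : ℝ) * ((∑ a ∈ range K, ((a : ℝ) / K) ^ 3) / K) =
      ∑ _v ∈ univ.filter (· ∉ Dset), (∑ a ∈ range K, ((a : ℝ) / K) ^ 3) / K := by
    rw [sum_const, nsmul_eq_mul]
  rw [hq, mul_sum]
  refine sum_le_sum fun v hv => ?_
  rw [mem_filter] at hv
  have hKr : (0 : ℝ) < K := by exact_mod_cast hK
  -- the depth-one cut event: all children placed before `α v`
  have hroot : (∑ a ∈ range K, ((a : ℝ) / K) ^ 3) / K ≤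
      prob fun β : PSpace Dset K K => pk.cutEvent 1 {v} (toNat β) (toNat β v) := by
    have hsz : size Dset K K v = K := by unfold size; split_ifs <;> rfl
    rw [prob_eq_sum_coord v]
    have hfib : ∀ x : Fin (size Dset K K v),
        prob (fun β : PSpace Dset K K => β v = x ∧ pk.cutEvent 1 {v} (toNat β) (toNat β v)) =
          (1 / (size Dset K K v : ℝ)) *
            prob fun β : PSpace Dset K K => pk.cutEvent 1 {v} (toNat β) x := by
      intro x
      have hig : Ignores v fun β : PSpace Dset K K => pk.cutEvent 1 {v} (toNat β) x :=
        pk.ignores_cutEvent 1 (mem_singleton_self v) x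
      have h1 := prob_coord_and v (fun y => y = x) hig (size_pos Dset hK hK v)
      have hc : ((univ.filter fun y : Fin (size Dset K K v) => y = x).card : ℝ) = 1 := by
        rw [filter_eq', if_pos (mem_univ x), card_singleton, Nat.cast_one]
      rw [hc] at h1
      rw [← h1]
      refine prob_congr fun β => ⟨?_, ?_⟩
      · rintro ⟨hβv, h⟩
        refine ⟨hβv, ?_⟩
        have : toNat β v = (x : ℕ) := by simp [toNat, hβv]
        rwa [this] at h
      · rintro ⟨hβv, h⟩
        refine ⟨hβv, ?_⟩
        have : toNat β v = (x : ℕ) := by simp [toNat, hβv]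
        rwa [this]
    simp only [hfib]
    rw [← mul_sum, hsz, one_div, inv_mul_eq_div]
    gcongr
    rw [Fin.sum_univ_eq_sum_range (fun a => prob fun β : PSpace Dset K K =>
      pk.cutEvent 1 {v} (toNat β) a) K]
    refine sum_le_sum fun a ha => ?_
    have haK : a ≤ K := (mem_range.1 ha).le
    -- `Pr[all ≤ 3 children before a] ≥ (a/K)^3`
    have hev : (fun β : PSpace Dset K K => pk.cutEvent 1 {v} (toNat β) a) =
        fun β => ∀ w ∈ pk.children {v}, toNat β w < a ∨ (w ∉ Dset ∧ pk.cutEvent 0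
          (insert w {v}) (toNat β) a) := rfl
    rw [hev]
    have hdown : ∀ w ∈ pk.children {v}, IsDown fun β : PSpace Dset K K =>
        toNat β w < a ∨ (w ∉ Dset ∧ pk.cutEvent 0 (insert w {v}) (toNat β) a) := fun w _ =>
      (isDown_lt w a).or fun _ _ h hβ => ⟨hβ.1, pk.isDown_cutEvent 0 _ a h hβ.2⟩
    refine le_trans ?_ (prob_forall_ge_prod (pk.children {v}) hdown hK hK)
    have hr0 : (0 : ℝ) ≤ a / K := by positivity
    have hr1 : (a : ℝ) / K ≤ 1 := by rw [div_le_one hKr]; exact_mod_cast haK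
    refine prod_ge_of_cube_ge _ (pk.card_children_le hz h4 (singleton_nonempty v)
      (disjoint_singleton_left.2 hv.2)) _ (pow_le_one₀ hr0 hr1) fun w _ =>
      ⟨prob_nonneg _, prob_le_one _, ?_⟩
    have hKw : prob (fun β : PSpace Dset K K => toNat β w < a ∨
        (w ∉ Dset ∧ pk.cutEvent 0 (insert w {v}) (toNat β) a)) =
          prob fun β : PSpace Dset K K => (β w : ℕ) < a :=
      prob_congr fun β => ⟨fun h => h.elim id fun h => by simp [cutEvent] at h, Or.inl⟩
    rw [hKw, prob_lt_eq hK hK w a]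
    have hszw : size Dset K K w = K := by unfold size; split_ifs <;> rfl
    rw [hszw, min_eq_left haK]
  have h2 := pk.prob_cutEvent_le_prob_isForced (K := K) (t := K) hz h4 (d := 1)
    (by simpa [treeSize] using hD) hv.2
  have h3 := hroot.trans h2
  rw [prob_eq, le_div_iff₀ (by exact_mod_cast card_pSpace_pos hK hK)] at h3
  rw [sum_boole]
  linarith

include pk in
/-- **Lemma 12's conclusion as a sum bound** (conditioned): with `q = (1/K)∑_{a<K} Q^{(d)}(a/K)`,
`|Ω_Γ| · 2^{q |N|} ≤ ∑_{α ∈ Ω_Γ} 2^{|Forced_z(α)|}`.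
[cite: PaturiPudlakSaksZane2005, Lemma 12 (τ(G, z|B) ≥ 2^{−(1−p)|N|} Prob[α ∈ Γ]) with eq. (7)] -/
theorem card_mul_rpow_le_sum (hz : Sat z G) (h4 : ∀ C ∈ G, C.length ≤ 4) (hK : 0 < K)
    (ht : 0 < t) (htK : 3 * t ≤ 2 * K) {d D : ℕ} (hD : treeSize d ≤ D) :
    (Fintype.card (PSpace Dset K t) : ℝ) *
        (2 : ℝ) ^ (((univ.filter (· ∉ Dset)).card : ℝ) * ((∑ a ∈ range K, Q d (a / K)) / K)) ≤
      ∑ β : PSpace Dset K t, (2 : ℝ) ^ (forcedCount G D z Dset (toNat β) : ℝ) := by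
  have hne : (univ : Finset (PSpace Dset K t)).Nonempty :=
    univ_nonempty_iff.2 (Fintype.card_pos_iff.1 (card_pSpace_pos hK ht))
  have hc : (0 : ℝ) < Fintype.card (PSpace Dset K t) := by exact_mod_cast card_pSpace_pos hK ht
  have hJ := card_mul_rpow_le_sum_rpow univ hne
    (fun β : PSpace Dset K t => (forcedCount G D z Dset (toNat β) : ℝ))
  rw [card_univ] at hJ
  refine le_trans ?_ hJ
  gcongr
  · norm_num
  · rw [le_div_iff₀ hc, mul_comm]
    exact pk.card_mul_le_sum_forcedCount hz h4 hK ht htK hD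

include pk in
/-- **Lemma 10's conclusion as a sum bound** (unconditioned): with `q₁ = (1/K)∑_{a<K}(a/K)^3`,
`|Ω| · 2^{q₁ |N|} ≤ ∑_{α ∈ Ω} 2^{|Forced_z(α)|}`. [cite: PaturiPudlakSaksZane2005, Lemma 10 with eq. (7)] -/
theorem card_mul_rpow_le_sum_one (hz : Sat z G) (h4 : ∀ C ∈ G, C.length ≤ 4) (hK : 0 < K)
    {D : ℕ} (hD : 1 ≤ D) :
    (Fintype.card (PSpace Dset K K) : ℝ) *
        (2 : ℝ) ^ (((univ.filter (· ∉ Dset)).card : ℝ) * ((∑ a ∈ range K, ((a : ℝ) / K) ^ 3) / K)) ≤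
      ∑ β : PSpace Dset K K, (2 : ℝ) ^ (forcedCount G D z Dset (toNat β) : ℝ) := by
  have hne : (univ : Finset (PSpace Dset K K)).Nonempty :=
    univ_nonempty_iff.2 (Fintype.card_pos_iff.1 (card_pSpace_pos hK hK))
  have hc : (0 : ℝ) < Fintype.card (PSpace Dset K K) := by exact_mod_cast card_pSpace_pos hK hK
  have hJ := card_mul_rpow_le_sum_rpow univ hne
    (fun β : PSpace Dset K K => (forcedCount G D z Dset (toNat β) : ℝ))
  rw [card_univ] at hJ
  refine le_trans ?_ hJ
  gcongr
  · norm_num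
  · rw [le_div_iff₀ hc, mul_comm]
    exact pk.card_mul_le_sum_forcedCount_one hz h4 hK hD

end Picker

end Forcing

end Literature.Computability.FineGrained.PPSZ
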